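import Literature.RepresentationTheory.Liu2021.LocalOscillatorStandingData
import Literature.NumberTheory.Automorphic.Liu2021.Def411AsPrinted
import Mathlib.NumberTheory.LocalField.Basic
import Mathlib.Topology.Algebra.Module.ModuleTopology
import HarnessLib

/-!
# Liu 2021, Appendix D, Lemma D.1 — EXACTLY AS PRINTED (§1: first sentence and item (1) over the single datum;
# §2: items (2)–(4) over the family of all triples) — statement-exact typing over the tree's hardened local
# oscillator data; no proof

[Liu2021] = Yifeng Liu, *Fourier–Jacobi cycles and arithmetic relative trace formula* (with an appendix by Chao Li
and Yihang Zhu), Cambridge J. Math. **9** (2021), no. 1, 1–147 = arXiv:2102.11518.  PRIMARY SOURCE READ FOR THIS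
FILE: the author's TeX source of the arXiv v2 e-print, `FJcycle.tex` (md5 `6db49a74122d2cb0f224fa1b39488a0c`, 7163
lines; held at `run/shared/lean/pub/pub-hodgecm/pub-hodgecm-cf-kudla-howe-rallis-g4/lit/Liu21-arxiv-src/FJcycle.tex`);
every `l. NNNN` below is a line of that file, `p0056 Lk` a chunk/line of the held extraction `paper:arxiv-2102.11518`
(chunk numbers are NOT journal pages; the extraction numbers Appendix D as «§10» and this lemma as «Lemma 10.1»;
Cambridge J. Math. page numbers are not held — `acq-07613` open — and are not quoted).  Numbering = compiled arXiv
v1 = v2 = the journal's numbering (cell record `HOME/lit/LIU2021.md` §0, finding F-11): this is **Lemma D.1**, TeX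
label `le:weil_nonarch`, l. 5226–5237 (`\begin{lem}` … `\end{lem}`), the first lemma of Appendix D «Cohomology of
unitary Shimura curves», §D.1 «Oscillator representations of local unitary groups» (heading l. 5207, label l. 5208).

## What this file is, and why

A statement-exact SIBLING of the tree's record
`Literature.RepresentationTheory.Liu2021.LocalOscillatorDatum.IrreducibleAdmissible`
(`Literature/RepresentationTheory/Liu2021/LocalOscillatorRepresentation.lean`; stage-1 registry row N-f1), which
transcribes the same lemma «in the direction the consumers use» — `IsAdmissible ∧ (Nontrivial W → IsIrreducible) ∧
(rank ≠ 2 → Nontrivial W)` — over the abstract datum `LocalOscillatorDatum G Z V W`.  The coordinator's ruling of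
2026-08-21T13:05:07Z («STATEMENT-EXACT TYPINGS … every printed hypothesis an explicit binder, quantifiers exactly as
the paper has them») and the red-team audit `AUDIT-CITESCOPE.md` (row (d): App. D Lem. D.1 (1) «not typed») ask for
the PRINTED sentence.  Item (1) speaks of objects the abstract datum does not carry — «`E` is a field», «`V` is
anisotropic», «`χ̌ = μ²`».  The tree ALREADY holds the standing data of §D.1 HARDENED on real carriers:
`Literature.RepresentationTheory.Liu2021.OscillatorStandingData F E n` (`LocalOscillatorStandingData.lean`: print's
involution `c` = `conj`, the hermitian space `(Eⁿ, gram)`, `ringChar F ≠ 2`, `E/F` formally étale of rank `2`,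
`n ≥ 2`; from it `U(V)(F) = S.U ≤ GL_n(E)` with the topology inherited from `E`, `E^1 = S.normOne ≤ E^×`, the
central scalars `S.scalar : E^1 →* U(V)`, print's `χ̌ = S.check χ`, `E^− = S.skew`, and the Liu datum `S.datum ω χ`
whose maximal `χ`-quotient `ω(μ, ε, χ)` is CONSTRUCTED as `CentralCharacterQuotient.quotRep`).  This file REUSES all
of it (nothing re-declared), adds the remaining printed data as explicit fields of ONE structure `LemD1Data F E n V`
— «`F` is nonarchimedean» (Mathlib `IsNonarchimedeanLocalField F`, with `E` carrying its module topology), Step 1's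
`ε`, Step 2's `μ` with its printed restriction property, Step 3's `χ` with values in `ℂ^1`, and the representation
`ω(μ, ε)` of `U(V)(F)` — states the first sentence and item (1) of Lemma D.1 VERBATIM as a predicate
`LemD1_1AsPrinted L`, and PROVES the implication «published ⇒ consumed»:
`LemD1_1AsPrinted L → L.datum.IrreducibleAdmissible` (`LemD1_1AsPrinted.irreducibleAdmissible`), together with the
shapes the supply-side consumers use (`….nontrivial_of_three_le`: for `n ≥ 3` the space of `ω(μ, ε, χ)` is
non-zero; `….isIrreducible`; `….isSmoothRep` / `….isAdmissibleRep`, the adjective shapes of the sibling record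
`Def411AsPrinted`).  As for every record of this directory: `LemD1_1AsPrinted L` is a PREDICATE on the consumer's datum
`L`; NOTHING IS ASSERTED here; `∀ L, LemD1_1AsPrinted L` is not Liu's lemma, is false on degenerate carriers (`omega`
is posited), and no declaration of this file has that type.  NO PROOF of the lemma (Track 2).  Items (2)–(4) of
Lemma D.1 (the contragredient; the isomorphism criteria for `n ≥ 3` and `n = 2`; l. 5231–5235) compare `ω(μ, ε, χ)`
for DIFFERENT triples; they are typed in §2 over the FAMILY datum `LemD1Family F E n` (the same standing data; ALL
`μ` of Step 2, ALL representatives `ε` of Step 1, ALL `χ` of Step 3 as REAL index sets; one ⟨CARRIER⟩ family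
`ω(μ, ε)`) as `LemD1_2AsPrinted`, `LemD1_3AsPrinted`, `LemD1_4AsPrinted`, with the first sentence + (1) at every
triple as `LemD1Family.Item1AsPrinted`.  (The tree's earlier record of (2)–(4) over BARE carriers is
`Literature.RepresentationTheory.Liu2021.LocalOscillatorFamily.LemmaD1_2/3/4`, `LocalOscillatorIsomorphismCriterion.lean`;
here the carriers are real.)

## The printed text (verbatim from `FJcycle.tex`; TeX macros resolved: `\tc` = `c`, `\Nm` = `Nm`, `\rU(\rV)` = `U(V)`,
`\Mp` = `Mp`, `\dC` = `ℂ`, `\check\chi` = `χ̌`)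

**§D.1, standing data**, l. 5213 (= p0056 L8): «Let `F` be a local field whose characteristic is not `2`. Let `E` be
an étale `F`-algebra of rank `2`. Denote by `c` the unique nontrivial involution on `E` that fixes `F`, and put
`E^− := {x ∈ E | x + x^c = 0}` and `E^1 := {x ∈ E | x x^c = 1}`. Let `V, ( , )_V` be a (non-degenerate) hermitian
space over `E` (with respect to `c`) of rank `n ≥ 2`.»  l. 5215–5222 (p0056 L10–16): «We recall the construction of
oscillator representations of `U(V)` in three steps.  [Step 1] Choose an element `ε ∈ E^{−×} / Nm_{E/F} E^×`. Let
`V_ε` be the underlying `F`-vector space of `V` equipped with the form `Tr_{E/F} ε ( , )_V`, which becomes a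
symplectic space.  (Footnote: More precisely, we have to choose an element in `E^{−×}` in the coset `ε`; and it is
known that the resulting oscillator representation depends only on `ε`.)  Let `Mp(V_ε)` be the metaplectic group of
`V_ε` with center `ℂ^1`. Then we have the oscillator representation `ω(ε)` of `Mp(V_ε)` using the standard additive
character `ψ_F`.  [Step 2] Choose a character `μ : E^× → ℂ^1` such that `μ|_{F^×}` is the unique character whose
kernel is exactly `Nm_{E/F} E^×`. Then we have the induced homomorphism `ι_μ : U(V) → Mp(V_ε)` (see, for example,
[HKS, Section 1]). Put `ω(μ, ε) := ω(ε) ∘ ι_μ`.  [Step 3] Choose a character `χ : E^1 → ℂ^1`. Let `ω(μ, ε, χ)` be the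
maximal quotient of the representation `ω(ε, μ)` of `U(V)` with central character `χ`.»  l. 5224 (p0056 L18): «For `χ`
in Step 3, we define a character `χ̌` of `E^×` via the formula `χ̌(x) = χ(x / x^c)`.»

**LEMMA D.1** (TeX label `le:weil_nonarch`, l. 5226–5237 = p0056 L20–29 for the whole lemma), first sentence (l. 5227 =
p0056 L21) and item (1) (l. 5229 = L23) VERBATIM:
«Suppose that `F` is nonarchimedean. Then `ω(μ, ε, χ)` is irreducible and admissible. Moreover,
 (1) `ω(μ, ε, χ)` is zero if and only if `E` is a field, `V` is anisotropic (in particular `n = 2`), and `χ̌ = μ²`.»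
[l. 5227–5229].  Items (2)–(4) VERBATIM (l. 5231 / 5233 / 5235 = p0056 L25 / L27 / L29; typed in §2): «(2) The
contragredient representation of `ω(μ, ε, χ)` is isomorphic
to `ω(μ^c, −ε, χ^{−1})`, where `μ^c := μ ∘ c` as usual. (3) If `n ≥ 3`, then `ω(μ', ε', χ')` is isomorphic to
`ω(μ, ε, χ)` if and only if `(μ', ε', χ') = (μ, ε, χ)`. (4) If `n = 2` and `ω(μ, ε, χ)` is nonzero, then `ω(μ', ε', χ')`
is isomorphic to `ω(μ, ε, χ)` if and only if either `(μ', ε', χ') = (μ, ε, χ)`, or `μ' = μ^c χ̌`, `χ' = χ`, and `ε' = ε`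
(resp. `ε' ≠ ε`) when `V` is isotropic (resp. anisotropic).» [l. 5231–5235].

NOT printed in the statement (and therefore NOT binders here): any condition on the residue characteristic beyond
«characteristic of `F` is not `2`», any condition on `μ` beyond Step 2, any condition on `χ` beyond Step 3, `n ≥ 3`.

## The typing (paper order; `⟨CARRIER⟩` = posited datum, as in `Thm418AsPrinted` and N-f1's datum)

* Parameters `F`, `E` with `[Field F] [ValuativeRel F] [TopologicalSpace F] [CommRing E] [Algebra F E]
  [TopologicalSpace E]`, the rank `n : ℕ`, and the `ℂ`-vector space `V` of `ω(μ, ε)`.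
* «`F` … a local field … Suppose that `F` is nonarchimedean» (l. 5213 + 5227): field `isNonarchimedeanLocalField :
  IsNonarchimedeanLocalField F` (Mathlib: valuation topology, locally compact, non-trivially valued) — REAL.  READING
  L1: Lemma D.1 is the non-archimedean case and the datum records that case (Lemma D.2, `F = ℝ`, is another statement).
  Field `isModuleTopology : IsModuleTopology F E` pins the topology of `E` as the canonical one of a finite-dimensional
  `F`-vector space (so that `U(V)(F) ≤ GL_n(E)` carries its natural topology — the one the word «admissible» refers to
  — and `μ`, `χ` can be said continuous).
* «characteristic not `2`», «étale `F`-algebra of rank `2`», «`c`», «`E^−`», «`E^1`», «`V, ( , )_V` … hermitian … of rank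
  `n ≥ 2`»: field `S : OscillatorStandingData F E n` — the TREE's hardened standing data, REAL (see above); `U(V)(F)` is
  `S.U`, `E^1` is `S.normOne`, `E^−` is `S.skew`, `χ̌` is `S.check χ`.  «`E` is a field» of item (1) is Mathlib's
  `IsField E`; «`V` is anisotropic» is `IsAnisotropic L := ∀ v, S.form v v = 0 → v = 0` (READING L2, the standard
  meaning; `S.form` = the tree's `hermForm c gram` on `Eⁿ`).
* Step 1: `eps : Eˣ` with `(eps : E) ∈ S.skew` — a REPRESENTATIVE of the class `ε ∈ E^{−×}/Nm_{E/F}E^×` (the footnote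
  l. 5217 says one is chosen; READING L3); it enters only the MEANING of `omega` (= `ω(ε) ∘ ι_μ`), as `μ` does.
* Step 2: `mu : Eˣ →* ℂˣ`, REAL, with `‖μ x‖ = 1` («`→ ℂ^1`»), continuous (READING L4: «character» = continuous
  homomorphism, as everywhere in the paper), and «`μ|_{F^×}` is the unique character whose kernel is exactly
  `Nm_{E/F}E^×`» typed as: for `a ∈ F^×`, `μ(a) = 1 ↔ a = x x^c` for some `x ∈ E^×`.
* Step 3: `chi : S.normOne →* ℂˣ` («`χ : E^1 → ℂ^1`»), REAL, with `‖χ z‖ = 1` and continuous (READING L4).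
* ⟨CARRIER⟩ `omega : Representation ℂ S.U V` = «`ω(μ, ε) := ω(ε) ∘ ι_μ`», the oscillator (Weil) representation of
  `Mp(V_ε)` for `ψ_F` pulled back along the splitting `ι_μ` of [HKS, §1] (Steps 1–2) — not constructible in Mathlib /
  the tree; its meaning is the object-match duty (b)/(om1) of N-f1's module docstring, unchanged.  «`ω(μ, ε, χ)` … the
  maximal quotient … with central character `χ`» is then CONSTRUCTED: `L.datum := S.datum omega chi` (tree), whose
  `quot` is `CentralCharacterQuotient.quotRep` on `V ⧸ augmentation omega S.scalar chi`.
* «irreducible» — READING I1 of the sibling `Def411AsPrinted` (cite-desk ruling of 2026-08-21, Pass 25):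
  `IsIrreducibleOrZero`, every subrepresentation is `0` or everything; THIS VERY SENTENCE is the reason for I1 (it
  calls `ω(μ, ε, χ)` «irreducible» and in the same breath allows it to be «zero»).  «admissible» — READING I2′: the
  tree's `Representation.IsAdmissible` (smooth, and finitely generated `K`-fixed vectors for every compact open `K`;
  [BernsteinZelevinsky1976, Def. 2.1]) — the reading of N-f1; it implies the sibling's I2 pair `IsSmoothRep ∧
  IsAdmissibleRep` (lemmas below).  «is zero» — READING L5: the representation space `V ⧸ augmentation …` of
  `ω(μ, ε, χ)` is the zero space (`Subsingleton`).
* READING D1 (the parenthetical).  «`V` is anisotropic (in particular `n = 2`)» is typed IN PLACE, as the conjunct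
  `IsAnisotropic ∧ n = 2` of the right-hand side — the words stand inside the right-hand side of the printed «if and
  only if».  This makes the record WEAKER-OR-EQUAL to print (print additionally asserts the parenthetical as a fact:
  an anisotropic hermitian space over a non-archimedean `E/F` has rank `≤ 2`; the record does not assert that fact on
  its own), and it is exactly what the consumers' non-vanishing for `n ≥ 3` uses (N-f1 retained ONLY this
  consequence, `rank ≠ 2 → Nontrivial W`).

* §2 (items (2)–(4)), over `LemD1Family F E n` (parameters as above plus `[IsTopologicalRing E]`, so that
  `U(V)(F) ≤ GL_n(E)` is a topological group): the index sets are REAL — `LemD1.MuSet S` = ALL `μ` of Step 2 (norm one,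
  continuous, kernel clause), `LemD1.EpsRep S` = representatives `e ∈ E^{−×}` (Step 1), `LemD1.ChiSet S` = ALL `χ` of
  Step 3 (norm one, continuous); ⟨CARRIER⟩ family `omega μ e : Representation ℂ S.U (V μ e)` = `ω(μ, ε)`; each
  `ω(μ, ε, χ)` = the constructed maximal `χ`-quotient (`Lf.single μ e χ` is the §1 datum at that triple, `Lf.quot μ e χ`
  its representation).  READING L3′: «`ε' = ε`» / «`(μ', ε', χ') = (μ, ε, χ)`» — equality of `μ`'s and `χ`'s as
  homomorphisms, and `SameClass e e'` («`e' = (x x^c) e` for some `x ∈ E^×`», i.e. equality in `E^{−×}/Nm_{E/F}E^×`)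
  for the representatives.  READING L6: «the contragredient representation» = the tree's SMOOTH contragredient
  `Representation.contragredientRep` (smooth vectors of the algebraic dual — the meaning of the word for smooth
  representations of `p`-adic groups, [BernsteinZelevinsky1976, §2.13]).  READING L7 (= R6 of `Thm418AsPrinted`):
  «isomorphic» = an intertwining `ℂ`-linear equivalence exists (`AreIsomorphicRep`).  `μ^c := μ ∘ c` is `LemD1.muConj`,
  `−ε` is `LemD1.epsNeg`, `χ^{−1}` is `LemD1.chiInv`, `μ^c χ̌` is `LemD1.muTwist` (with `χ̌ = S.check χ`) — each PROVED
  to land in the printed index set again; «`V` is isotropic» = `LemD1.IsIsotropic S` (a non-zero `v` with `(v, v)_V = 0`,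
  READING L2; `LemD1Data.isAnisotropic_iff_not_isIsotropic`); «`ω(μ, ε, χ)` is nonzero» = the quotient space is
  non-trivial (READING L5).

READINGS I1, I2′, L1–L7, L3′, D1 are the only interpretive choices; none adds a hypothesis, D1 is weaker-or-equal, the
rest are the standard meanings of the printed words.  A consumer takes `(h : LemD1_1AsPrinted L)` (resp.
`LemD1_2/3/4AsPrinted Lf`) for ITS OWN datum.

## References

* [Liu2021] Y. Liu, *Fourier–Jacobi cycles and arithmetic relative trace formula*, Camb. J. Math. 9 (2021) 1–147,
  arXiv:2102.11518 — App. D §D.1 l. 5207–5224; Lemma D.1 (`le:weil_nonarch`) l. 5226–5237.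
* [BernsteinZelevinsky1976] I. N. Bernstein, A. V. Zelevinsky, *Representations of the group GL(n, F) where F is a
  non-archimedean local field*, Russian Math. Surveys 31 (1976) — §2.1 (smooth, admissible), §2.13 (contragredient).
-/

noncomputable section

open Literature.RepresentationTheory.Liu2021 (LocalOscillatorDatum OscillatorStandingData)
open Literature.RepresentationTheory.CentralCharacterQuotient (augmentation quotRep)

namespace Literature.NumberTheory.Automorphic.Liu2021

/-! ## The data of §D.1 and Lemma D.1, in paper order, over the tree's hardened standing data -/

/-- **The data and standing hypotheses of [Liu2021, App. D §D.1 + Lemma D.1]** at one non-archimedean place, over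
the parameters `F`, `E` (with their topologies), the rank `n` and the space `V` of `ω(μ, ε)`: «`F` is nonarchimedean»
(a non-archimedean local field, Mathlib), `E` with its module topology, the TREE's hardened standing data
`S : OscillatorStandingData F E n` (`c`, the hermitian space `(Eⁿ, gram)`, `ringChar F ≠ 2`, `E/F` étale of rank `2`,
`n ≥ 2`; giving `U(V)(F) = S.U`, `E^1 = S.normOne`, `E^− = S.skew`, `χ̌ = S.check χ`), Step 1's `ε`, Step 2's `μ`,
Step 3's `χ`, and the ⟨CARRIER⟩ `omega = ω(μ, ε)`.  See the module docstring («The typing»).  Nothing is asserted by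
this structure. [cite: Liu2021, App. D §D.1 (l. 5213–5224) and Lemma D.1 (l. 5226–5229)] -/
structure LemD1Data (F E : Type) [Field F] [ValuativeRel F] [TopologicalSpace F] [CommRing E] [Algebra F E]
    [TopologicalSpace E] (n : ℕ) (V : Type) [AddCommGroup V] [Module ℂ V] where
  /-- «Let `F` be a local field» (l. 5213) … «Suppose that `F` is nonarchimedean» (l. 5227) — REAL: Mathlib's
  `IsNonarchimedeanLocalField` (READING L1). -/
  isNonarchimedeanLocalField : IsNonarchimedeanLocalField F
  /-- The topology of `E` is the canonical one of a finite-dimensional `F`-vector space (Mathlib `IsModuleTopology`),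
  whence the natural topology of `U(V)(F) ≤ GL_n(E)` and of `E^× ⊇ E^1`. -/
  isModuleTopology : IsModuleTopology F E
  /-- The standing data of §D.1 (l. 5213), the TREE's `OscillatorStandingData`: «characteristic … not `2`», «étale
  `F`-algebra of rank `2`», the involution `c`, the «(non-degenerate) hermitian space … of rank `n ≥ 2`». -/
  S : OscillatorStandingData F E n
  /-- Step 1 (l. 5217): «Choose an element `ε ∈ E^{−×} / Nm_{E/F} E^×` … (footnote) we have to choose an element in
  `E^{−×}` in the coset `ε`» — a representative, a unit of `E` … (READING L3) -/
  eps : Eˣ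
  /-- … lying in `E^− = {x | x + x^c = 0}` (the tree's `S.skew`). -/
  eps_mem_skew : (eps : E) ∈ S.skew
  /-- Step 2 (l. 5219): «Choose a character `μ : E^× → ℂ^1` …» — REAL, as a homomorphism `E^× → ℂ^×` … -/
  mu : Eˣ →* ℂˣ
  /-- … with values in `ℂ^1`, … -/
  norm_mu : ∀ x : Eˣ, ‖((mu x : ℂˣ) : ℂ)‖ = 1
  /-- … continuous («character», READING L4), … -/
  continuous_mu : Continuous fun x : Eˣ => ((mu x : ℂˣ) : ℂ)
  /-- … «such that `μ|_{F^×}` is the unique character whose kernel is exactly `Nm_{E/F} E^×`»: for `a ∈ F^×`,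
  `μ(a) = 1 ↔ a = x x^c` for some `x ∈ E^×`. -/
  mu_algebraMap_eq_one_iff : ∀ a : Fˣ,
    mu (Units.map (algebraMap F E).toMonoidHom a) = 1 ↔ ∃ x : Eˣ, (x : E) * S.conj x = algebraMap F E a
  /-- Step 3 (l. 5221): «Choose a character `χ : E^1 → ℂ^1`» — REAL, on the tree's `E^1 = S.normOne ≤ E^×` … -/
  chi : S.normOne →* ℂˣ
  /-- … with values in `ℂ^1` … -/
  norm_chi : ∀ z : S.normOne, ‖((chi z : ℂˣ) : ℂ)‖ = 1
  /-- … and continuous (READING L4). -/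
  continuous_chi : Continuous fun z : S.normOne => ((chi z : ℂˣ) : ℂ)
  /-- ⟨CARRIER⟩ «`ω(μ, ε) := ω(ε) ∘ ι_μ`» (Steps 1–2, l. 5217–5219): the oscillator representation of `Mp(V_ε)` for the
  standard additive character `ψ_F`, pulled back to `U(V)(F) = S.U` along the splitting `ι_μ` of [HKS, §1] determined
  by `μ` — posited (no Weil representation in Mathlib / the tree); object-match duty (b)/(om1) of N-f1. -/
  omega : Representation ℂ S.U V

namespace LemD1Data

variable {F E : Type} [Field F] [ValuativeRel F] [TopologicalSpace F] [CommRing E] [Algebra F E]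
  [TopologicalSpace E] {n : ℕ} {V : Type} [AddCommGroup V] [Module ℂ V] (L : LemD1Data F E n V)

/-- **`ω(μ, ε, χ)` as the tree's Liu datum** (Step 3, l. 5221: «the maximal quotient of the representation `ω(ε, μ)`
of `U(V)` with central character `χ`»): `S.datum omega chi` of `LocalOscillatorStandingData.lean` — `G := U(V)(F)`,
`Z := E^1`, `zeta :=` the scalars, and `quot :=` the CONSTRUCTED maximal `χ`-quotient
`CentralCharacterQuotient.quotRep` on `V ⧸ augmentation omega S.scalar chi`. [cite: Liu2021, App. D §D.1 Step 3] -/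
def datum : LocalOscillatorDatum L.S.U L.S.normOne V (V ⧸ augmentation L.omega L.S.scalar L.chi) :=
  L.S.datum L.omega L.chi

/-- Unfolding: the representation `ω(μ, ε, χ)` of the datum is `quotRep`. [cite: Liu2021, App. D §D.1 Step 3] -/
@[simp] theorem datum_quot : L.datum.quot = quotRep L.omega L.S.scalar_mem_center L.chi := rfl

/-- Unfolding: the datum's rank is `n`. [cite: Liu2021, App. D §D.1 l. 5213] -/
@[simp] theorem datum_rank : L.datum.rank = n := rfl

/-- The chosen representative `ε` satisfies `ε + ε^c = 0` (field `eps_mem_skew`, tree `mem_skew_iff`).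
[cite: Liu2021, App. D §D.1 Step 1] -/
theorem eps_add_conj_eps : (L.eps : E) + L.S.conj L.eps = 0 := (L.S.mem_skew_iff _).1 L.eps_mem_skew

/-- «`V` is anisotropic» (item (1), l. 5229): the hermitian form `( , )_V` (the tree's `S.form = hermForm c gram` on
`Eⁿ`) has no non-zero isotropic vector (READING L2). [cite: Liu2021, App. D Lemma D.1 (1)] -/
def IsAnisotropic : Prop := ∀ v : Fin n → E, L.S.form v v = 0 → v = 0

/-- «`χ̌`» of the datum (l. 5224: «`χ̌(x) = χ(x / x^c)`») is the tree's `S.check chi`; unfolding.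
[cite: Liu2021, App. D §D.1 l. 5224] -/
theorem check_apply (x : Eˣ) : L.S.check L.chi x = L.chi (L.S.divConj x) := rfl

end LemD1Data

/-! ## Lemma D.1, first sentence and item (1), exactly as printed -/

/-- **[Liu2021, App. D, Lemma D.1 — first sentence and item (1)] EXACTLY AS PRINTED** (`FJcycle.tex` l. 5226–5229 =
`paper:arxiv-2102.11518` p0056 L21 / L23), for the datum `L` (§D.1 l. 5213–5224: `F` a local field of characteristic
`≠ 2` — non-archimedean, as the lemma supposes —, `E/F` étale of rank `2` with involution `c`, `(V, ( , )_V)`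
hermitian of rank `n ≥ 2`, `ε`, `μ`, `χ` as in Steps 1–3, `ω(μ, ε, χ)` the maximal `χ`-quotient of `ω(ε, μ)|_{U(V)}`):

«Suppose that `F` is nonarchimedean. Then `ω(μ, ε, χ)` is irreducible and admissible. Moreover, (1) `ω(μ, ε, χ)` is
zero if and only if `E` is a field, `V` is anisotropic (in particular `n = 2`), and `χ̌ = μ²`.»

TYPED as the conjunction of: (first sentence) the representation `L.datum.quot` (= `quotRep`, the maximal
`χ`-quotient) of `U(V)(F) = S.U` on `V ⧸ augmentation ω scalar χ = ω(μ, ε, χ)` is irreducible in the paper's sense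
(READING I1, `IsIrreducibleOrZero`: zero allowed — this sentence is why) and admissible (READING I2′, the tree's
`Representation.IsAdmissible`, for the topology of `U(V)(F) ≤ GL_n(E)` inherited from `E`); (1) that space is the
zero space (READING L5) IF AND ONLY IF `E` is a field (`IsField`) ∧ (`V` is anisotropic ∧ `n = 2` — the parenthetical
typed in place, READING D1, weaker-or-equal) ∧ `χ̌(x) = μ(x)²` for all `x ∈ E^×` (`χ̌ = S.check χ`).  No hypothesis
added, none dropped.  A consumer takes `(h : LemD1_1AsPrinted L)` for ITS OWN `L`; `∀ L, LemD1_1AsPrinted L` is not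
the lemma and is not claimed.  NO PROOF (Track 2). [cite: Liu2021, App. D Lemma D.1 (1)] -/
def LemD1_1AsPrinted {F E : Type} [Field F] [ValuativeRel F] [TopologicalSpace F] [CommRing E] [Algebra F E]
    [TopologicalSpace E] {n : ℕ} {V : Type} [AddCommGroup V] [Module ℂ V] (L : LemD1Data F E n V) : Prop :=
  -- «Then ω(μ, ε, χ) is irreducible and admissible.» (l. 5227)
  (IsIrreducibleOrZero L.datum.quot ∧ L.datum.quot.IsAdmissible) ∧
  -- «(1) ω(μ, ε, χ) is zero if and only if E is a field, V is anisotropic (in particular n = 2), and χ̌ = μ².» (l. 5229)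
  (Subsingleton (V ⧸ augmentation L.omega L.S.scalar L.chi) ↔
    (IsField E ∧ (L.IsAnisotropic ∧ n = 2) ∧ ∀ x : Eˣ, L.S.check L.chi x = L.mu x ^ 2))

namespace LemD1Data

variable {F E : Type} [Field F] [ValuativeRel F] [TopologicalSpace F] [CommRing E] [Algebra F E]
  [TopologicalSpace E] {n : ℕ} {V : Type} [AddCommGroup V] [Module ℂ V]

/-- Dot-notation alias: `L.LemD1_1AsPrinted`. [cite: Liu2021, App. D Lemma D.1 (1)] -/
protected abbrev LemD1_1AsPrinted (L : LemD1Data F E n V) : Prop := Liu2021.LemD1_1AsPrinted L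

end LemD1Data

/-! ## Consequences in the shapes the consumers use (bookkeeping; every declaration below is proved) -/

namespace LemD1_1AsPrinted

variable {F E : Type} [Field F] [ValuativeRel F] [TopologicalSpace F] [CommRing E] [Algebra F E]
  [TopologicalSpace E] {n : ℕ} {V : Type} [AddCommGroup V] [Module ℂ V] {L : LemD1Data F E n V}

/-- First sentence, «irreducible» (READING I1). [cite: Liu2021, App. D Lemma D.1] -/
theorem isIrreducibleOrZero (h : LemD1_1AsPrinted L) : IsIrreducibleOrZero L.datum.quot := h.1.1

/-- First sentence, «admissible» (READING I2′, the tree's `Representation.IsAdmissible`). [cite: Liu2021, App. D Lemma D.1] -/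
theorem isAdmissible (h : LemD1_1AsPrinted L) : L.datum.quot.IsAdmissible := h.1.2

/-- «admissible» entails smooth (tree `IsAdmissible.isSmooth`). [cite: Liu2021, App. D Lemma D.1] -/
theorem isSmooth (h : LemD1_1AsPrinted L) : L.datum.quot.IsSmooth := h.1.2.isSmooth

/-- Item (1), as the printed equivalence. [cite: Liu2021, App. D Lemma D.1 (1)] -/
theorem subsingleton_iff (h : LemD1_1AsPrinted L) :
    Subsingleton (V ⧸ augmentation L.omega L.S.scalar L.chi) ↔
      (IsField E ∧ (L.IsAnisotropic ∧ n = 2) ∧ ∀ x : Eˣ, L.S.check L.chi x = L.mu x ^ 2) :=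
  h.2

/-- Item (1), direction «zero ⇒»: if `ω(μ, ε, χ) = 0` then `E` is a field. [cite: Liu2021, App. D Lemma D.1 (1)] -/
theorem isField_of_subsingleton (h : LemD1_1AsPrinted L)
    [Subsingleton (V ⧸ augmentation L.omega L.S.scalar L.chi)] : IsField E :=
  (h.2.1 ‹_›).1

/-- Item (1), direction «zero ⇒»: if `ω(μ, ε, χ) = 0` then `V` is anisotropic. [cite: Liu2021, App. D Lemma D.1 (1)] -/
theorem isAnisotropic_of_subsingleton (h : LemD1_1AsPrinted L)
    [Subsingleton (V ⧸ augmentation L.omega L.S.scalar L.chi)] : L.IsAnisotropic :=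
  (h.2.1 ‹_›).2.1.1

/-- Item (1), direction «zero ⇒», the parenthetical: if `ω(μ, ε, χ) = 0` then `n = 2`. [cite: Liu2021, App. D Lemma D.1 (1)] -/
theorem rank_eq_two_of_subsingleton (h : LemD1_1AsPrinted L)
    [Subsingleton (V ⧸ augmentation L.omega L.S.scalar L.chi)] : n = 2 :=
  (h.2.1 ‹_›).2.1.2

/-- Item (1), direction «zero ⇒»: if `ω(μ, ε, χ) = 0` then `χ̌ = μ²`. [cite: Liu2021, App. D Lemma D.1 (1)] -/
theorem check_eq_mu_sq_of_subsingleton (h : LemD1_1AsPrinted L)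
    [Subsingleton (V ⧸ augmentation L.omega L.S.scalar L.chi)] (x : Eˣ) : L.S.check L.chi x = L.mu x ^ 2 :=
  (h.2.1 ‹_›).2.2 x

/-- **Non-vanishing outside the exceptional rank** (contrapositive of «zero ⇒ … (in particular `n = 2`)»): if `n ≠ 2`
then `ω(μ, ε, χ)` is a non-zero space — the clause N-f1 retains. [cite: Liu2021, App. D Lemma D.1 (1)] -/
theorem nontrivial (h : LemD1_1AsPrinted L) (hn : n ≠ 2) :
    Nontrivial (V ⧸ augmentation L.omega L.S.scalar L.chi) := by
  by_contra hW
  rw [not_nontrivial_iff_subsingleton] at hW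
  exact hn h.rank_eq_two_of_subsingleton

/-- The supply-side shape: for `n ≥ 3` (the Hodge/CM cell: `n = 3`) `ω(μ, ε, χ) ≠ 0`. [cite: Liu2021, App. D Lemma D.1 (1)] -/
theorem nontrivial_of_three_le (h : LemD1_1AsPrinted L) (hn : 3 ≤ n) :
    Nontrivial (V ⧸ augmentation L.omega L.S.scalar L.chi) :=
  h.nontrivial (by omega)

/-- First sentence on a non-zero space: `ω(μ, ε, χ)` is irreducible in Mathlib's sense. [cite: Liu2021, App. D Lemma D.1] -/
theorem isIrreducible (h : LemD1_1AsPrinted L) [Nontrivial (V ⧸ augmentation L.omega L.S.scalar L.chi)] :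
    L.datum.quot.IsIrreducible :=
  isIrreducible_of_nontrivial h.1.1

/-- For `n ≥ 3`: `ω(μ, ε, χ)` is (non-zero and) irreducible in Mathlib's sense. [cite: Liu2021, App. D Lemma D.1] -/
theorem isIrreducible_of_three_le (h : LemD1_1AsPrinted L) (hn : 3 ≤ n) : L.datum.quot.IsIrreducible := by
  haveI := h.nontrivial_of_three_le hn
  exact h.isIrreducible

/-- **PUBLISHED ⇒ CONSUMED.**  Lemma D.1 (first sentence + (1)) AS PRINTED implies the tree's record N-f1
`LocalOscillatorDatum.IrreducibleAdmissible` of the datum `L.datum = S.datum ω χ` — `IsAdmissible ∧ (Nontrivial W →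
IsIrreducible) ∧ (rank ≠ 2 → Nontrivial W)` — so a consumer holding `(h : LemD1_1AsPrinted L)` feeds
`h.irreducibleAdmissible` wherever `(Dloc).IrreducibleAdmissible` is asked for (the CITATION-FIT implication,
kernel-checked). [cite: Liu2021, App. D Lemma D.1 (1)] -/
theorem irreducibleAdmissible (h : LemD1_1AsPrinted L) : L.datum.IrreducibleAdmissible :=
  ⟨h.isAdmissible, fun hW => by haveI := hW; exact h.isIrreducible, fun hn => h.nontrivial hn⟩

/-- The same, unfolded on the constructed quotient (tree `irreducibleAdmissible_datum_iff`).
[cite: Liu2021, App. D Lemma D.1 (1)] -/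
theorem irreducibleAdmissible_quotRep (h : LemD1_1AsPrinted L) :
    (quotRep L.omega L.S.scalar_mem_center L.chi).IsAdmissible ∧
      (Nontrivial (V ⧸ augmentation L.omega L.S.scalar L.chi) →
        (quotRep L.omega L.S.scalar_mem_center L.chi).IsIrreducible) ∧
      (n ≠ 2 → Nontrivial (V ⧸ augmentation L.omega L.S.scalar L.chi)) :=
  (L.S.irreducibleAdmissible_datum_iff L.omega L.chi).1 h.irreducibleAdmissible

/-- «admissible» in the sibling's READING I2, first half: every vector of `ω(μ, ε, χ)` is fixed by an open subgroup of
`U(V)(F)` (`IsSmoothRep`, the shape of the stage-2 binder `hsm`) — from the tree's `IsSmooth` (the stabiliser itself is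
that open subgroup). [cite: Liu2021, App. D Lemma D.1] -/
theorem isSmoothRep (h : LemD1_1AsPrinted L) : IsSmoothRep L.datum.quot := fun v =>
  ⟨L.datum.quot.stabilizerSubgroup v, h.isSmooth v, fun _ hk => hk⟩

/-- «admissible» in the sibling's READING I2, second half: finite-dimensional `K`-fixed vectors for every open compact
`K ≤ U(V)(F)` (`IsAdmissibleRep`) — from the tree's `IsAdmissible` (`fixedSubmodule ρ K` and `ρ.fixedPoints K` are the
same submodule). [cite: Liu2021, App. D Lemma D.1] -/
theorem isAdmissibleRep (h : LemD1_1AsPrinted L) : IsAdmissibleRep L.datum.quot := fun K hK =>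
  h.isAdmissible.finite_fixedPoints ⟨K, hK.1⟩ hK.2

end LemD1_1AsPrinted

/-! ## §2 Items (2)–(4) of Lemma D.1, exactly as printed, over the FAMILY of all triples `(μ, ε, χ)`
Items (2)–(4) compare `ω(μ, ε, χ)` for DIFFERENT triples, so they are typed over a
family datum `LemD1Family F E n`: the same REAL standing data `S : OscillatorStandingData F E n` and local-field layer
as `LemD1Data`, the printed index sets made REAL — `MuSet S` (Step 2: `μ : E^× → ℂ^1` continuous with `μ|_{F^×}`
of kernel exactly `Nm E^×`), `EpsRep S` (Step 1: a representative `e ∈ E^{−×}` of the class `ε`; «`ε' = ε`» in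
`E^{−×}/Nm_{E/F}E^×` is `SameClass`, READING L3′), `ChiSet S` (Step 3: `χ : E^1 → ℂ^1` continuous) — and ONE
⟨CARRIER⟩ family `omega μ e : Representation ℂ S.U (V μ e)` = `ω(μ, ε) = ω(ε) ∘ ι_μ`; every `ω(μ, ε, χ)` is then the
CONSTRUCTED maximal `χ`-quotient (`(Lf.single μ e χ).datum`, the single datum of §1 at that triple).  «contragredient» =
the tree's smooth contragredient `Representation.contragredientRep` (READING L6); «isomorphic» = an intertwining
`ℂ`-linear equivalence exists (`AreIsomorphicRep`, READING L7 = R6 of `Thm418AsPrinted`); `μ^c = μ ∘ c` (`muConj`),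
`−ε` (`epsNeg`), `χ^{−1}` (`chiInv`), `μ^c χ̌` (`muTwist`, `χ̌ = S.check χ`), «`V` is isotropic» = a non-zero `v` with
`(v, v)_V = 0` (READING L2).  The tree's token record of (2)–(4), `LocalOscillatorFamily.LemmaD1_2/3/4`
(`LocalOscillatorIsomorphismCriterion.lean`), is the same text over bare carriers; here the carriers are real. -/

section Family

variable {F E : Type} [Field F] [CommRing E] [Algebra F E] [TopologicalSpace E] {n : ℕ}

namespace LemD1

/-- Step 2 (l. 5219), the set of ALL `μ`: «a character `μ : E^× → ℂ^1` such that `μ|_{F^×}` is the unique character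
whose kernel is exactly `Nm_{E/F} E^×`» — norm one, continuous (READING L4), kernel clause.
[cite: Liu2021, App. D §D.1 Step 2] -/
def MuSet (S : OscillatorStandingData F E n) : Type :=
  {μ : Eˣ →* ℂˣ // (∀ x : Eˣ, ‖((μ x : ℂˣ) : ℂ)‖ = 1) ∧ (Continuous fun x : Eˣ => ((μ x : ℂˣ) : ℂ)) ∧
    ∀ a : Fˣ, μ (Units.map (algebraMap F E).toMonoidHom a) = 1 ↔ ∃ x : Eˣ, (x : E) * S.conj x = algebraMap F E a}

/-- Step 1 (l. 5217), representatives: «an element in `E^{−×}` in the coset `ε`» — a unit of `E` lying in `E^−`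
(`S.skew`). [cite: Liu2021, App. D §D.1 Step 1] -/
def EpsRep (S : OscillatorStandingData F E n) : Type := {e : Eˣ // (e : E) ∈ S.skew}

/-- Step 3 (l. 5221), the set of ALL `χ`: «a character `χ : E^1 → ℂ^1`» — norm one, continuous (READING L4).
[cite: Liu2021, App. D §D.1 Step 3] -/
def ChiSet (S : OscillatorStandingData F E n) : Type :=
  {χ : S.normOne →* ℂˣ // (∀ z : S.normOne, ‖((χ z : ℂˣ) : ℂ)‖ = 1) ∧ Continuous fun z : S.normOne => ((χ z : ℂˣ) : ℂ)}

variable {S : OscillatorStandingData F E n}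

/-- READING L3′: «`ε' = ε`» in `E^{−×} / Nm_{E/F} E^×` for representatives: `e' = (x x^c) · e` for some `x ∈ E^×`.
[cite: Liu2021, App. D §D.1 Step 1] -/
def SameClass (e e' : EpsRep S) : Prop := ∃ x : Eˣ, (e'.1 : Eˣ) = x * Units.map (S.σ : E →* E) x * e.1

/-- «`−ε`» (item (2)): the representative `−e` (still in `E^−`). [cite: Liu2021, App. D Lemma D.1 (2)] -/
def epsNeg (e : EpsRep S) : EpsRep S :=
  ⟨-e.1, by rw [Units.val_neg]; exact S.skew.neg_mem e.2⟩

/-- «`χ^{−1}`» (item (2)): the inverse character (norm one and continuous again). [cite: Liu2021, App. D Lemma D.1 (2)] -/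
def chiInv (χ : ChiSet S) : ChiSet S :=
  ⟨χ.1⁻¹, fun z => by rw [MonoidHom.inv_apply, Units.val_inv_eq_inv_val, norm_inv, χ.2.1 z, inv_one],
    by
      have h : (fun z : S.normOne => (((χ.1⁻¹ : S.normOne →* ℂˣ) z : ℂˣ) : ℂ)) =
          fun z => (((χ.1 z : ℂˣ) : ℂ))⁻¹ := by
        funext z; rw [MonoidHom.inv_apply, Units.val_inv_eq_inv_val]
      rw [h]
      exact χ.2.2.inv₀ fun z => Units.ne_zero _⟩


omit [TopologicalSpace E] in
/-- At `a ∈ F^×` one has `a / a^c = 1`, so `χ̌(a) = 1`. [cite: Liu2021, App. D §D.1 l. 5224] -/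
theorem check_algebraMap (χ : S.normOne →* ℂˣ) (a : Fˣ) :
    S.check χ (Units.map (algebraMap F E).toMonoidHom a) = 1 := by
  have hfix : Units.map (S.σ : E →* E) (Units.map (algebraMap F E).toMonoidHom a) =
      Units.map (algebraMap F E).toMonoidHom a :=
    Units.ext (S.conj.commutes (a : F))
  have h1 : S.divConj (Units.map (algebraMap F E).toMonoidHom a) = 1 := by
    apply Subtype.ext
    rw [OscillatorStandingData.coe_divConj, hfix, div_eq_mul_inv, mul_inv_cancel, OneMemClass.coe_one]
  rw [OscillatorStandingData.check_apply, h1, map_one]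

section Topological

variable [TopologicalSpace F] [IsTopologicalRing E] [IsModuleTopology F E]

/-- `c` is continuous on `E` (an `F`-linear map for the module topology). [cite: Liu2021, App. D §D.1 l. 5213] -/
theorem continuous_conj : Continuous fun x : E => S.conj x :=
  IsModuleTopology.continuous_of_linearMap S.conj.toLinearMap

/-- `x ↦ x^c` is continuous on `E^×`. [cite: Liu2021, App. D §D.1 l. 5213] -/
theorem continuous_map_σ : Continuous fun x : Eˣ => Units.map (S.σ : E →* E) x :=
  Units.continuous_map (f := (S.σ : E →* E)) (continuous_conj (S := S))

/-- «`μ^c := μ ∘ c`» (item (2)) is again a character as in Step 2: norm one, continuous, and with the same restriction to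
`F^×` (`c` fixes `F`). [cite: Liu2021, App. D Lemma D.1 (2)] -/
def muConj (μ : MuSet S) : MuSet S :=
  ⟨μ.1.comp (Units.map (S.σ : E →* E)),
    fun x => μ.2.1 _,
    μ.2.2.1.comp (continuous_map_σ (S := S)),
    fun a => by
      have hfix : Units.map (S.σ : E →* E) (Units.map (algebraMap F E).toMonoidHom a) =
          Units.map (algebraMap F E).toMonoidHom a :=
        Units.ext (S.conj.commutes (a : F))
      rw [MonoidHom.comp_apply, hfix]
      exact μ.2.2.2 a⟩

/-- Unfolding of `muConj`: `μ^c(x) = μ(x^c)`. [cite: Liu2021, App. D Lemma D.1 (2)] -/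
@[simp] theorem muConj_apply (μ : MuSet S) (x : Eˣ) :
    (muConj μ).1 x = μ.1 (Units.map (S.σ : E →* E) x) := rfl

/-- `χ̌ = χ ∘ (x ↦ x / x^c)` is continuous on `E^×` for a continuous `χ`. [cite: Liu2021, App. D §D.1 l. 5224] -/
theorem continuous_check (χ : ChiSet S) : Continuous fun x : Eˣ => ((S.check χ.1 x : ℂˣ) : ℂ) := by
  have hdiv : Continuous fun x : Eˣ => (S.divConj x : S.normOne) := by
    refine Continuous.subtype_mk ?_ _
    exact continuous_id.div' (continuous_map_σ (S := S))
  exact χ.2.2.comp hdiv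

/-- «`μ^c χ̌`» (item (4)): the character `x ↦ μ(x^c) χ(x / x^c)` is again as in Step 2 (norm one, continuous, and
`χ̌|_{F^×} = 1`). [cite: Liu2021, App. D Lemma D.1 (4)] -/
def muTwist (μ : MuSet S) (χ : ChiSet S) : MuSet S :=
  ⟨(muConj μ).1 * S.check χ.1,
    fun x => by
      rw [MonoidHom.mul_apply, Units.val_mul, norm_mul, (muConj μ).2.1 x]
      have : ‖((S.check χ.1 x : ℂˣ) : ℂ)‖ = 1 := χ.2.1 _
      rw [this, mul_one],
    by
      have h : (fun x : Eˣ => ((((muConj μ).1 * S.check χ.1) x : ℂˣ) : ℂ)) =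
          fun x => (((muConj μ).1 x : ℂˣ) : ℂ) * ((S.check χ.1 x : ℂˣ) : ℂ) := by
        funext x; rw [MonoidHom.mul_apply, Units.val_mul]
      rw [h]
      exact (muConj μ).2.2.1.mul (continuous_check χ),
    fun a => by
      rw [MonoidHom.mul_apply, check_algebraMap, mul_one]
      exact (muConj μ).2.2.2 a⟩

end Topological

/-- «`V` is isotropic» (item (4)): the hermitian space `(Eⁿ, ( , )_V)` has a non-zero vector `v` with `(v, v)_V = 0`
(READING L2). [cite: Liu2021, App. D Lemma D.1 (4)] -/
def IsIsotropic (S : OscillatorStandingData F E n) : Prop := ∃ v : Fin n → E, v ≠ 0 ∧ S.form v v = 0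

end LemD1

end Family

/-- READING L7 («isomorphic», items (2)–(4); = READING R6 of `Thm418AsPrinted`): two representations of the same
group on `ℂ`-vector spaces are isomorphic when an intertwining `ℂ`-linear equivalence exists.
[cite: Liu2021, App. D Lemma D.1 (2)–(4)] -/
def AreIsomorphicRep {G : Type*} [Group G] {V₁ : Type*} {V₂ : Type*} [AddCommGroup V₁] [Module ℂ V₁]
    [AddCommGroup V₂] [Module ℂ V₂] (ρ₁ : Representation ℂ G V₁) (ρ₂ : Representation ℂ G V₂) : Prop :=
  ∃ f : V₁ ≃ₗ[ℂ] V₂, ∀ (g : G) (v : V₁), f (ρ₁ g v) = ρ₂ g (f v)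

/-- **The data of [Liu2021, App. D §D.1 + Lemma D.1] over ALL triples `(μ, ε, χ)`** (needed by items (2)–(4), which
compare `ω(μ, ε, χ)` for different triples): the local-field layer and the tree's standing data `S` as in
`LemD1Data`, and ONE ⟨CARRIER⟩ family `omega μ e = ω(μ, ε) = ω(ε) ∘ ι_μ` on spaces `V μ e`, indexed by the REAL index
sets `MuSet S` (Step 2) and `EpsRep S` (Step 1, representatives).  `E` is a topological ring (parameter) so that
`U(V)(F) ≤ GL_n(E)` is a topological group and the contragredient of item (2) makes sense.  Nothing is asserted.
[cite: Liu2021, App. D §D.1 (l. 5213–5224) and Lemma D.1 (l. 5226–5237)] -/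
structure LemD1Family (F E : Type) [Field F] [ValuativeRel F] [TopologicalSpace F] [CommRing E] [Algebra F E]
    [TopologicalSpace E] [IsTopologicalRing E] (n : ℕ) : Type 1 where
  /-- «`F` … a local field … nonarchimedean» (l. 5213, 5227), Mathlib (READING L1). -/
  isNonarchimedeanLocalField : IsNonarchimedeanLocalField F
  /-- the topology of `E` is its module topology over `F`. -/
  isModuleTopology : IsModuleTopology F E
  /-- the standing data of §D.1 (tree `OscillatorStandingData`). -/
  S : OscillatorStandingData F E n
  /-- ⟨CARRIER⟩ the space of `ω(μ, ε)` for `μ` as in Step 2 and a representative `e` of `ε` as in Step 1 … -/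
  V : LemD1.MuSet S → LemD1.EpsRep S → Type
  [instAddCommGroupV : ∀ μ e, AddCommGroup (V μ e)]
  [instModuleV : ∀ μ e, Module ℂ (V μ e)]
  /-- ⟨CARRIER⟩ … with its `U(V)(F)`-action: «`ω(μ, ε) := ω(ε) ∘ ι_μ`» (Steps 1–2; the oscillator representation of
  `Mp(V_ε)` for `ψ_F` pulled back along `ι_μ`, «depends only on `ε`» — footnote l. 5217); N-f1 duty (b)/(om1). -/
  omega : ∀ μ e, Representation ℂ S.U (V μ e)

attribute [instance] LemD1Family.instAddCommGroupV LemD1Family.instModuleV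

namespace LemD1Family

variable {F E : Type} [Field F] [ValuativeRel F] [TopologicalSpace F] [CommRing E] [Algebra F E]
  [TopologicalSpace E] [IsTopologicalRing E] {n : ℕ} (Lf : LemD1Family F E n)

/-- The single-triple datum of §1 at `(μ, e, χ)`: same local field, same standing data, `ε := e`, `μ`, `χ`,
`ω(μ, ε) := omega μ e`. [cite: Liu2021, App. D §D.1 Steps 1–3] -/
def single (μ : LemD1.MuSet Lf.S) (e : LemD1.EpsRep Lf.S) (χ : LemD1.ChiSet Lf.S) : LemD1Data F E n (Lf.V μ e) where
  isNonarchimedeanLocalField := Lf.isNonarchimedeanLocalField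
  isModuleTopology := Lf.isModuleTopology
  S := Lf.S
  eps := e.1
  eps_mem_skew := e.2
  mu := μ.1
  norm_mu := μ.2.1
  continuous_mu := μ.2.2.1
  mu_algebraMap_eq_one_iff := μ.2.2.2
  chi := χ.1
  norm_chi := χ.2.1
  continuous_chi := χ.2.2
  omega := Lf.omega μ e

/-- `ω(μ, ε, χ)` in the family: the representation of `U(V)(F)` on the maximal `χ`-quotient of `ω(μ, ε)` (constructed,
`= (Lf.single μ e χ).datum.quot = quotRep …`). [cite: Liu2021, App. D §D.1 Step 3] -/
abbrev quot (μ : LemD1.MuSet Lf.S) (e : LemD1.EpsRep Lf.S) (χ : LemD1.ChiSet Lf.S) :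
    Representation ℂ Lf.S.U (Lf.V μ e ⧸ augmentation (Lf.omega μ e) Lf.S.scalar χ.1) :=
  (Lf.single μ e χ).datum.quot

end LemD1Family

/-- **[Liu2021, App. D, Lemma D.1, first sentence and item (1)] for every triple of the family**: at each
`(μ, ε, χ)` the single-datum record `LemD1_1AsPrinted (Lf.single μ e χ)` of §1. [cite: Liu2021, App. D Lemma D.1 (1)] -/
def LemD1Family.Item1AsPrinted {F E : Type} [Field F] [ValuativeRel F] [TopologicalSpace F] [CommRing E]
    [Algebra F E] [TopologicalSpace E] [IsTopologicalRing E] {n : ℕ} (Lf : LemD1Family F E n) : Prop :=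
  ∀ μ e χ, LemD1_1AsPrinted (Lf.single μ e χ)

/-- **[Liu2021, App. D, Lemma D.1 (2)] EXACTLY AS PRINTED** (l. 5231 = p0056 L25): «The contragredient representation
of `ω(μ, ε, χ)` is isomorphic to `ω(μ^c, −ε, χ^{−1})`, where `μ^c := μ ∘ c` as usual.»  TYPED: for every triple, the
smooth contragredient (tree `Representation.contragredientRep`, READING L6) of `ω(μ, ε, χ)` and `ω(μ^c, −ε, χ^{−1})`
(`muConj`, `epsNeg`, `chiInv`) are isomorphic (READING L7).  A predicate on `Lf`; not asserted; NO PROOF.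
[cite: Liu2021, App. D Lemma D.1 (2)] -/
def LemD1_2AsPrinted {F E : Type} [Field F] [ValuativeRel F] [TopologicalSpace F] [CommRing E] [Algebra F E]
    [TopologicalSpace E] [IsTopologicalRing E] {n : ℕ} (Lf : LemD1Family F E n) : Prop :=
  letI : IsModuleTopology F E := Lf.isModuleTopology
  ∀ (μ : LemD1.MuSet Lf.S) (e : LemD1.EpsRep Lf.S) (χ : LemD1.ChiSet Lf.S),
    AreIsomorphicRep (Lf.quot μ e χ).contragredientRep (Lf.quot (LemD1.muConj μ) (LemD1.epsNeg e) (LemD1.chiInv χ))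

/-- **[Liu2021, App. D, Lemma D.1 (3)] EXACTLY AS PRINTED** (l. 5233 = p0056 L27): «If `n ≥ 3`, then `ω(μ', ε', χ')` is
isomorphic to `ω(μ, ε, χ)` if and only if `(μ', ε', χ') = (μ, ε, χ)`.»  TYPED: for `3 ≤ n` and all triples,
`ω(μ', ε', χ')` ≅ `ω(μ, ε, χ)` (READING L7) iff `μ' = μ`, `ε' = ε` in `E^{−×}/Nm E^×` (`SameClass`, READING L3′) and
`χ' = χ`.  A predicate on `Lf`; not asserted; NO PROOF. [cite: Liu2021, App. D Lemma D.1 (3)] -/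
def LemD1_3AsPrinted {F E : Type} [Field F] [ValuativeRel F] [TopologicalSpace F] [CommRing E] [Algebra F E]
    [TopologicalSpace E] [IsTopologicalRing E] {n : ℕ} (Lf : LemD1Family F E n) : Prop :=
  3 ≤ n → ∀ (μ μ' : LemD1.MuSet Lf.S) (e e' : LemD1.EpsRep Lf.S) (χ χ' : LemD1.ChiSet Lf.S),
    AreIsomorphicRep (Lf.quot μ' e' χ') (Lf.quot μ e χ) ↔ (μ' = μ ∧ LemD1.SameClass e e' ∧ χ' = χ)

/-- **[Liu2021, App. D, Lemma D.1 (4)] EXACTLY AS PRINTED** (l. 5235 = p0056 L29): «If `n = 2` and `ω(μ, ε, χ)` is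
nonzero, then `ω(μ', ε', χ')` is isomorphic to `ω(μ, ε, χ)` if and only if either `(μ', ε', χ') = (μ, ε, χ)`, or
`μ' = μ^c χ̌`, `χ' = χ`, and `ε' = ε` (resp. `ε' ≠ ε`) when `V` is isotropic (resp. anisotropic).»  TYPED: for `n = 2`,
every triple with `ω(μ, ε, χ) ≠ 0` (the quotient space non-trivial, READING L5) and every second triple: `ω(μ', ε', χ')`
≅ `ω(μ, ε, χ)` iff EITHER `μ' = μ ∧ ε' = ε (SameClass) ∧ χ' = χ`, OR `μ' = μ^c χ̌` (`muTwist`, `χ̌ = S.check χ`) `∧ χ' = χ ∧`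
(`V` isotropic `→ ε' = ε`) `∧` (`V` anisotropic `→ ε' ≠ ε`).  A predicate on `Lf`; not asserted; NO PROOF.
[cite: Liu2021, App. D Lemma D.1 (4)] -/
def LemD1_4AsPrinted {F E : Type} [Field F] [ValuativeRel F] [TopologicalSpace F] [CommRing E] [Algebra F E]
    [TopologicalSpace E] [IsTopologicalRing E] {n : ℕ} (Lf : LemD1Family F E n) : Prop :=
  letI : IsModuleTopology F E := Lf.isModuleTopology
  n = 2 → ∀ (μ : LemD1.MuSet Lf.S) (e : LemD1.EpsRep Lf.S) (χ : LemD1.ChiSet Lf.S),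
    Nontrivial (Lf.V μ e ⧸ augmentation (Lf.omega μ e) Lf.S.scalar χ.1) →
    ∀ (μ' : LemD1.MuSet Lf.S) (e' : LemD1.EpsRep Lf.S) (χ' : LemD1.ChiSet Lf.S),
      AreIsomorphicRep (Lf.quot μ' e' χ') (Lf.quot μ e χ) ↔
        ((μ' = μ ∧ LemD1.SameClass e e' ∧ χ' = χ) ∨
          (μ' = LemD1.muTwist μ χ ∧ χ' = χ ∧ (LemD1.IsIsotropic Lf.S → LemD1.SameClass e e') ∧
            (¬ LemD1.IsIsotropic Lf.S → ¬ LemD1.SameClass e e')))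

namespace LemD1Family

variable {F E : Type} [Field F] [ValuativeRel F] [TopologicalSpace F] [CommRing E] [Algebra F E]
  [TopologicalSpace E] [IsTopologicalRing E] {n : ℕ} {Lf : LemD1Family F E n}

/-- From the family form of item (1): for `n ≥ 3` every `ω(μ, ε, χ)` of the family is a non-zero space (so the
hypothesis «`ω(μ, ε, χ)` is nonzero» of item (4) never bites at `n ≥ 3`, and item (3) applies).
[cite: Liu2021, App. D Lemma D.1 (1)] -/
theorem Item1AsPrinted.nontrivial_of_three_le (h : Lf.Item1AsPrinted) (hn : 3 ≤ n) (μ : LemD1.MuSet Lf.S)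
    (e : LemD1.EpsRep Lf.S) (χ : LemD1.ChiSet Lf.S) :
    Nontrivial (Lf.V μ e ⧸ augmentation (Lf.omega μ e) Lf.S.scalar χ.1) :=
  (h μ e χ).nontrivial_of_three_le hn

/-- Item (3) in use: for `n ≥ 3`, isomorphic `ω`'s of the family have the same `μ` (the local print anchor of
[Liu2021] Thm. 4.18 (2), «Statement (2) follows from Lemma D.1», l. 2270). [cite: Liu2021, App. D Lemma D.1 (3)] -/
theorem mu_eq_of_areIsomorphicRep (h3 : LemD1_3AsPrinted Lf) (hn : 3 ≤ n) {μ μ' : LemD1.MuSet Lf.S}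
    {e e' : LemD1.EpsRep Lf.S} {χ χ' : LemD1.ChiSet Lf.S} (hiso : AreIsomorphicRep (Lf.quot μ' e' χ') (Lf.quot μ e χ)) :
    μ' = μ :=
  ((h3 hn μ μ' e e' χ χ').1 hiso).1

/-- … and the same `χ` and the same class of `ε`. [cite: Liu2021, App. D Lemma D.1 (3)] -/
theorem sameClass_and_chi_eq_of_areIsomorphicRep (h3 : LemD1_3AsPrinted Lf) (hn : 3 ≤ n) {μ μ' : LemD1.MuSet Lf.S}
    {e e' : LemD1.EpsRep Lf.S} {χ χ' : LemD1.ChiSet Lf.S} (hiso : AreIsomorphicRep (Lf.quot μ' e' χ') (Lf.quot μ e χ)) :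
    LemD1.SameClass e e' ∧ χ' = χ :=
  ((h3 hn μ μ' e e' χ χ').1 hiso).2

end LemD1Family

/-- Coherence of READING L2 between §1 and §2: «anisotropic» (no non-zero isotropic vector) is the negation of
«isotropic». [cite: Liu2021, App. D Lemma D.1 (1), (4)] -/
theorem LemD1Data.isAnisotropic_iff_not_isIsotropic {F E : Type} [Field F] [ValuativeRel F] [TopologicalSpace F]
    [CommRing E] [Algebra F E] [TopologicalSpace E] {n : ℕ} {V : Type} [AddCommGroup V] [Module ℂ V]
    (L : LemD1Data F E n V) : L.IsAnisotropic ↔ ¬ LemD1.IsIsotropic L.S := by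
  unfold LemD1Data.IsAnisotropic LemD1.IsIsotropic
  constructor
  · rintro h ⟨v, hv, hvv⟩
    exact hv (h v hvv)
  · intro h v hvv
    by_contra hv
    exact h ⟨v, hv, hvv⟩

end Literature.NumberTheory.Automorphic.Liu2021

end
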